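import Summits.CriticalPhenomena.CardyFormulaZ2.Theorems.CardyUniqueLimitCardyRigidityPercDrivingTailOfFace
import Summits.CriticalPhenomena.CardyFormulaZ2.Theorems.CardyUniqueLimitCardyRigidityPercFreshArmG2
import Literature.Probability.LatticeModels.MedialInterfaceMeasurability
import HarnessLib

/-!
# Condition G2 in `ℍ` for the face-domain system from the annulus-transfer input
(line `crossing-martingale`, crux `CardyRigidity`, stub A2″ `stub_percFaceHalfPlaneG2`)

Crux `Summit.CriticalPhenomena.CardyFormulaZ2.Theses.CardyUniqueLimit.CardyRigidity`
(stmt-CriticalPhenomena-0746), line `crossing_martingale`.  STUB A2″ is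
`stub_percFaceHalfPlaneG2 : Driver.PercFaceHalfPlaneG2` (`…PercDrivingTailOfFace.lean`):
Kemppainen–Smirnov's Condition G2 read in `ℍ` (boundary annuli `A(z₀, 2√u, 2C√u)`, `z₀ ∈ ℝ`,
`|z₀| ≤ Z`, pasts avoiding the outer disc, eventually along the meshes) for the capacity-`u`
truncations of the bond-`ℤ²` interfaces pulled back through chordal maps `φ_k` of the ORIENTED
FACE DOMAINS.  Its proof has a probabilistic half — Russo–Seymour–Welsh for FRESH arms and the
domain Markov property in integrated form, both LANDED in `…PercFreshArmG2.lean`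
(`exists_const_freshArm_le_half`, `measure_preimage_inter_le_mul_of_freshArm`) — and a
deterministic half (Kemppainen–Smirnov 2017, §2.2 with §4.1–4.2): (T1) the conformal transfer
"a crossing of the half-annulus `A(z₀, r, Cr) ∩ ℍ` is, in `φ_k`-coordinates, a crossing of a
ROUND annulus of `δ_k ℤ²` of ratio `≥ C'` above the lattice scale" (length–area / conformal
modulus, uniformly over all Jordan domains), (T2) the factorisation of the continuum past
`stopAt F` of the truncated pulled-back interface through a discrete exploration past whose
fibres are cylinder events of revealed edges, and (T3) "an exploration segment crossing a round
annulus away from its past carries a fresh open arm on its left or a fresh closed dual arm on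
its right" (the side chains of the medial exploration).  None of (T1)–(T3) is in the tree.

This file isolates the deterministic half as ONE predicate and proves the rest:

* `Driver.headClass γ u` — the class of the initial piece `t ↦ γ (u t)` of a path
  `γ : C([0,∞), ℂ)` (source `γ 0`, trace `γ '' [0, u]`); `Driver.headClassOfFun` — the same for
  a bare function, junk when discontinuous (used on `Loewner.trace`, a.s. continuous);
* `Driver.countable_range_of_medialExploration` — a function of the configuration factoring
  through the medial exploration has countable range (companion of the tree's
  `measurable_of_medialExploration`);
* `Driver.PercFaceAnnulusTransfer` (definition) — the deterministic half (T1)–(T3) in the exact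
  instances needed: `∃ c₁ > 0, ∀ C', ∃ C > 1`, for the binder block of `PercFaceHalfPlaneG2`
  (without its box hypothesis), `∀ u > 0, ∀ Z, ∀ᶠ k, ∀ F` closed nonempty, `∀ |z₀| ≤ Z`: a round
  annulus `A(x; ρ, ρ')` with `c₁ δ_k ≤ ρ`, `C' ρ ≤ ρ'`, and a countable-valued discrete past
  `pref` with measurable fibres determined by revealed edge sets `Rev d`, such that for every
  configuration whose interface is the compactified image of a Loewner pair `(γ̂, W)` from `0`
  (the a.s. structure given by box tightness, `Driver.ae_exists_pair_of_boxTight`):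
  the past `stopAt F (headClass γ̂ u)` is a function of `pref ω`, and
  [past avoids `B(z₀, 2C√u)`] ∧ [future crosses `A(z₀, 2√u, 2C√u)`] forces a fresh open or
  closed dual arm of `ω` across `A(x; ρ, ρ')` off `Rev (pref ω)`;
* `Driver.percFaceHalfPlaneG2_of_annulusTransfer` and the registered-shape
  `faceG2_percFaceHalfPlaneG2_of_annulusTransfer : PercFaceAnnulusTransfer → PercFaceHalfPlaneG2`
  — the probabilistic half: the truncation `crv ω = headClassOfFun (Loewner.trace (drivingFunction
  φ_k (interface ω))) u` is measurable with countable range (it factors through the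
  exploration), has a.s. source `0` and the required trace (a.s. Loewner pair), and its law obeys
  the crossing bound with the RSW ratio of `exists_const_freshArm_le_half` (decoupling over the
  values of the discrete past on the a.s. good set, `measure_preimage_inter_le_mul_of_freshArm`).

AUDIT of the predicate (recorded for the lead): `PercFaceHalfPlaneG2` asks the bound only for
annuli of inner radius `2√u` at centres `|z₀| ≤ Z` with `u`, `Z` FIXED before `∀ᶠ k`; by (U1),
(U2) their `φ_k`-images are macroscopic uniformly in `z₀` for large `k` while `δ_k → 0`, so the
sub-mesh counterexample to the tree's literal `ConditionG2` for the raw medial polyline (270°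
re-entry at a once-visited vertex) does not apply; pasts avoiding the open outer disc make every
crossing unforced (`ℍ` simply connected), the reversed orientation of `Literature.Probability.Percolation.bondInterfaceIn` is again
an exploration (percolation interfaces are reversible), and KS §2.2 gives ONE ratio for all
Jordan domains — the predicate is a consequence of KS Prop. 2.6 + Prop. 4.7/Remark 4.8 and is
believed TRUE as stated; it is not provable from the tree without (T1)–(T3).

References: A. Kemppainen, S. Smirnov, Ann. Probab. 45 (2017) 698–779, §2.1.3, §2.2
(Prop. 2.6), §4.1.4, §4.2 (Prop. 4.7, Remark 4.8); O. Schramm, S. Smirnov, Ann. Probab. 39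
(2011), proof of Lemma 6.1; G. Grimmett, *Percolation* (1999), §11.7–11.8.
-/

noncomputable section

open MeasureTheory Filter Set Topology Metric
open scoped NNReal ENNReal unitInterval
open UpperHalfPlane (upperHalfPlaneSet)
open Literature.Probability Literature.Probability.RandomPlanarGeometry
  Literature.Probability.LatticeModels Literature.Probability.Percolation
open scoped Literature.Probability.RandomPlanarGeometry.PathBorel

namespace Summit.CriticalPhenomena.CardyFormulaZ2.Cruxes.CardyRigidity.CrossingMartingale

namespace Driver

/-! ### The capacity-`u` head of a path, as a curve class -/

/-- The class of the initial piece `γ|[0, u]` of a path `γ : [0, ∞) → ℂ`, parametrised on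
`[0, 1]` by `t ↦ γ (u t)`. [folklore] -/
def headClass (γ : C(ℝ≥0, ℂ)) (u : ℝ≥0) : CurveClass ℂ :=
  CurveClass.mk ⟨γ.comp ⟨fun t : I ↦ u * Real.toNNReal (t : ℝ),
    continuous_const.mul (continuous_real_toNNReal.comp continuous_subtype_val)⟩⟩

/-- The head class starts at `γ 0`. [folklore] -/
theorem source_headClass (γ : C(ℝ≥0, ℂ)) (u : ℝ≥0) : (headClass γ u).source = γ 0 := by
  change γ (u * Real.toNNReal ((0 : I) : ℝ)) = γ 0
  simp

/-- The trace of the head class is `γ '' [0, u]` (`u > 0`). [folklore] -/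
theorem range_headClass (γ : C(ℝ≥0, ℂ)) {u : ℝ≥0} (hu : 0 < u) :
    (headClass γ u).range = γ '' Icc 0 u := by
  change Set.range (fun t : I ↦ γ (u * Real.toNNReal (t : ℝ))) = γ '' Icc 0 u
  ext z
  constructor
  · rintro ⟨t, rfl⟩
    refine ⟨u * Real.toNNReal (t : ℝ), ⟨zero_le, ?_⟩, rfl⟩
    have h1 : Real.toNNReal (t : ℝ) ≤ 1 := (Real.toNNReal_le_toNNReal t.2.2).trans_eq Real.toNNReal_one
    exact mul_le_of_le_one_right zero_le h1
  · rintro ⟨s, ⟨-, hsu⟩, rfl⟩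
    have hsu' : ((s / u : ℝ≥0) : ℝ) ≤ 1 := by
      have : s / u ≤ 1 := div_le_one_of_le₀ hsu zero_le
      exact_mod_cast this
    refine ⟨⟨((s / u : ℝ≥0) : ℝ), NNReal.coe_nonneg _, hsu'⟩, ?_⟩
    change γ (u * Real.toNNReal ((s / u : ℝ≥0) : ℝ)) = γ s
    rw [Real.toNNReal_coe, ← mul_div_assoc, mul_div_cancel_left₀ _ hu.ne']

open Classical in
/-- The head class of a bare path `γ : [0, ∞) → ℂ`: `headClass ⟨γ, _⟩ u` when `γ` is continuous,
and the documented junk class of the constant curve `0` otherwise (applied to `Loewner.trace`,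
which is a.s. a continuous curve). [folklore] -/
def headClassOfFun (γ : ℝ≥0 → ℂ) (u : ℝ≥0) : CurveClass ℂ :=
  if h : Continuous γ then headClass ⟨γ, h⟩ u else CurveClass.mk (Curve.const 0)

/-- On (the coercion of) a continuous path, `headClassOfFun` is `headClass`. [folklore] -/
theorem headClassOfFun_coe (γ : C(ℝ≥0, ℂ)) (u : ℝ≥0) : headClassOfFun γ u = headClass γ u := by
  have h : (⟨⇑γ, γ.continuous⟩ : C(ℝ≥0, ℂ)) = γ := ContinuousMap.ext fun _ ↦ rfl
  rw [headClassOfFun, dif_pos γ.continuous, h]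

/-! ### Functions of the exploration have countable range -/

/-- **A function of the bond configuration that depends on `ω` only through the medial
exploration `medialExploration E ω` has countable range** (the list type is countable;
companion of `measurable_of_medialExploration`). [folklore] -/
theorem countable_range_of_medialExploration {X : Type*} (E : DiscreteDobrushin)
    {G : BondConfig (Site 2) → X}
    (hG : ∀ ω ω', medialExploration E ω = medialExploration E ω' → G ω = G ω') :
    (Set.range G).Countable := by
  classical
  let g : List MedialVertex → X := fun l ↦
    G (if h : ∃ ω, medialExploration E ω = l then h.choose else ∅)
  have hGg : ∀ ω, G ω = g (medialExploration E ω) := fun ω ↦ by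
    have h : ∃ ω', medialExploration E ω' = medialExploration E ω := ⟨ω, rfl⟩
    simp only [g, dif_pos h]
    exact hG _ _ h.choose_spec.symm
  refine (Set.countable_range g).mono ?_
  rintro _ ⟨ω, rfl⟩
  exact ⟨medialExploration E ω, (hGg ω).symm⟩

/-! ### The deterministic input: annulus transfer, discrete past, fresh arms -/

/-- **The annulus-transfer input for Condition G2 in `ℍ` of the face-domain system** (the
deterministic half of Kemppainen–Smirnov's verification of Condition G2 for percolation, read
in `ℍ`): there is a lattice constant `c₁ > 0` such that for every target ratio `C'` some ratio
`C > 1` works as follows.  For every Dobrushin domain `(D; a, b)`, discretisation family `Λ`,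
chordal `φ`, positive admissible meshes `δ_k → 0` and chordal maps `φ_k` of the oriented face
domains `orientedFaceDomain hΛ (hadm k)` with (U1), (U2) (the binder block of
`PercFaceHalfPlaneG2`, box tightness excepted), for every capacity horizon `u > 0` and bound `Z`,
for all large `k`, for every nonempty closed `F` and real centre `|z₀| ≤ Z` there are
(T1) a ROUND annulus `A(x; ρ, ρ')` of the plane of `δ_k ℤ²` above the lattice scale,
`c₁ δ_k ≤ ρ`, of ratio `C' ρ ≤ ρ'`, and (T2) a discrete past `pref` with countably many values,
measurable fibres `{pref = d}` determined by revealed edge sets `Rev d`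
(`Percolation.DeterminedBy`), such that for every configuration `ω` whose interface
`Literature.Probability.Percolation.bondInterfaceIn D (Λ δ_k) ω` is the compactified image `⟦Φ_k ∘ γ̂⟧` of a Loewner pair
`(γ̂, W) ∈ generatedPairs` from `0` with `drivingFunction φ_k = W` (the almost-sure structure
supplied by box tightness): the continuum past `stopAt F (headClass γ̂ u)` of the capacity-`u`
truncation depends on `ω` only through `pref ω` (among such configurations), and (T3) if that
past avoids the open disc `B(z₀, 2C√u)` while the future `startFrom F (headClass γ̂ u)` makes a
crossing of `A(z₀, 2√u, 2C√u)`, then `ω` has an open path of `δ_k ℤ²` or a closed dual path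
crossing `A(x; ρ, ρ')` and using no edge of `Rev (pref ω)` (`annulusOpenCrossingOff`,
`annulusDualCrossingOff`).  Mathematically: the conformal-modulus transfer of crossings of
`φ_k(A(z₀, r, Cr) ∩ ℍ)` to round annuli (Kemppainen–Smirnov 2017, §2.2, proof of Prop. 2.6),
the exploration prefix stopped at the first medial edge meeting `φ_k(F)` or capacity `u`
(cylinder events, §4.2), and the side chains of the medial exploration of bond percolation
(§4.1.4, proof of Prop. 4.3 / Remark 4.8) — a sub-goal PREDICATE of the crux (the deterministic
core of stub A2″), deliberately not a cited Literature fact. -/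
def PercFaceAnnulusTransfer : Prop :=
  ∃ c₁ : ℝ, 0 < c₁ ∧ ∀ C' : ℝ, ∃ C : ℝ, 1 < C ∧
  ∀ (D : DobrushinDomain) (Λ : ℝ → DiscreteDobrushin) (hΛ : ZdDiscretisationFamily D Λ)
    (φ : ConformalEquiv upperHalfPlaneSet D.carrier), D.IsChordalUniformizing φ →
    ∀ (δs : ℕ → ℝ), (∀ k, 0 < δs k) → Tendsto δs atTop (𝓝 0) →
    ∀ (hadm : ∀ k, (Λ (δs k)).IsZdAdmissible)
      (φs : ∀ k, ConformalEquiv upperHalfPlaneSet (orientedFaceDomain hΛ (hadm k)).carrier),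
      (∀ k, (orientedFaceDomain hΛ (hadm k)).IsChordalUniformizing (φs k)) →
      (∀ R : ℝ, TendstoUniformlyOn (fun k ↦ (φs k).boundaryExtension) φ.boundaryExtension
        atTop ({z : ℂ | 0 ≤ z.im} ∩ closedBall 0 R)) →
      (∀ ε : ℝ, 0 < ε → ∃ r : ℝ, ∀ᶠ k in atTop, ∀ z : ℂ, z ∈ {z : ℂ | 0 ≤ z.im} → r ≤ ‖z‖ →
        dist ((φs k).boundaryExtension z) ((orientedFaceDomain hΛ (hadm k)).pt 1) ≤ ε) →
      ∀ u : ℝ≥0, 0 < u → ∀ Z : ℝ, ∀ᶠ k in atTop,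
        ∀ F : Set ℂ, IsClosed F → F.Nonempty → ∀ z₀ : ℝ, |z₀| ≤ Z →
          ∃ (x : ℂ) (ρ ρ' : ℝ), c₁ * δs k ≤ ρ ∧ C' * ρ ≤ ρ' ∧
          ∃ (κ : Type) (_ : Countable κ) (pref : BondConfig (Site 2) → κ)
            (Rev : κ → Set (Sym2 (Site 2))),
            (∀ d, MeasurableSet (pref ⁻¹' {d})) ∧
            (∀ d, DeterminedBy (pref ⁻¹' {d}) (Rev d)) ∧
            ∀ (ω : BondConfig (Site 2)) (p : C(ℝ≥0, ℂ) × C(ℝ≥0, ℝ)), p ∈ generatedPairs →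
              p.1 0 = 0 → p.2 0 = 0 →
              Literature.Probability.Percolation.bondInterfaceIn D (Λ (δs k)) ω =
                compactifiedClass (φs k).boundaryExtension
                  ((orientedFaceDomain hΛ (hadm k)).pt 1) p.1 →
              drivingFunction (φs k) (Literature.Probability.Percolation.bondInterfaceIn D (Λ (δs k)) ω) = p.2 →
              (∀ (ω' : BondConfig (Site 2)) (p' : C(ℝ≥0, ℂ) × C(ℝ≥0, ℝ)), p' ∈ generatedPairs →
                  p'.1 0 = 0 → p'.2 0 = 0 →
                  Literature.Probability.Percolation.bondInterfaceIn D (Λ (δs k)) ω' =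
                    compactifiedClass (φs k).boundaryExtension
                      ((orientedFaceDomain hΛ (hadm k)).pt 1) p'.1 →
                  drivingFunction (φs k) (Literature.Probability.Percolation.bondInterfaceIn D (Λ (δs k)) ω') = p'.2 →
                  pref ω = pref ω' →
                  CurveClass.stopAt F (headClass p.1 u) = CurveClass.stopAt F (headClass p'.1 u)) ∧
              (Disjoint (CurveClass.stopAt F (headClass p.1 u)).range
                  (ball ((z₀ : ℝ) : ℂ) (C * (2 * Real.sqrt u))) →
                (headClass p.1 u).startFrom F ∈ CurveClass.crossingIn ((z₀ : ℝ) : ℂ)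
                  (2 * Real.sqrt u) (C * (2 * Real.sqrt u)) univ →
                ω ∈ annulusOpenCrossingOff (Rev (pref ω)) x (δs k) ρ ρ' ∪
                  annulusDualCrossingOff (Rev (pref ω)) x (δs k) ρ ρ')

/-! ### Condition G2 in `ℍ` for the face-domain system from the transfer input -/

/-- **Condition G2 in `ℍ` for the face-domain system from the annulus-transfer input**
(Kemppainen–Smirnov's Prop. 4.7 / Remark 4.8 — Condition G2 for percolation from
Russo–Seymour–Welsh and the domain Markov property — read in `ℍ` through the chordal maps of
the oriented face domains, modulo its deterministic half `PercFaceAnnulusTransfer`).  The ratio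
is the `C` that the transfer input attaches to the RSW ratio of `exists_const_freshArm_le_half`;
the curve classes are the capacity-`u` heads of the Loewner traces of the driving functions
(measurable with countable range — they factor through the exploration —, a.s. from `0` with
trace `γ̂_k[0, u]` by `ae_exists_pair_of_boxTight`); the bound is the decoupling
`measure_preimage_inter_le_mul_of_freshArm` over the values of the discrete past, on the a.s.
set of configurations carrying a Loewner pair.
[cite: KemppainenSmirnov2017, §4.2 Prop. 4.7 and Remark 4.8, §2.2 Prop. 2.6] -/
theorem percFaceHalfPlaneG2_of_annulusTransfer (hT : PercFaceAnnulusTransfer) :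
    PercFaceHalfPlaneG2 := by
  obtain ⟨c₁, hc₁, hT⟩ := hT
  obtain ⟨Cp, -, -, hhalf⟩ := exists_const_freshArm_le_half 0 hc₁ le_rfl
  obtain ⟨C, hC, hT⟩ := hT Cp
  refine ⟨C, hC, ?_⟩
  intro D Λ hΛ φ hφ δs hpos hlim hadm φs hφs hU1 hU2 hbox u hu Z
  filter_upwards [hT D Λ hΛ φ hφ δs hpos hlim hadm φs hφs hU1 hU2 u hu Z] with k hk
  set P : Measure (BondConfig (Site 2)) := bondPercolation (zdGraph 2) half with hP
  haveI : IsProbabilityMeasure P := by rw [hP]; infer_instance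
  -- the a.s. Loewner pair behind the interface at scale `k`
  have hgood : ∀ᵐ ω ∂P, ∃ p : C(ℝ≥0, ℂ) × C(ℝ≥0, ℝ), p ∈ generatedPairs ∧ p.1 0 = 0 ∧
      p.2 0 = 0 ∧ Literature.Probability.Percolation.bondInterfaceIn D (Λ (δs k)) ω = compactifiedClass (φs k).boundaryExtension
        ((orientedFaceDomain hΛ (hadm k)).pt 1) p.1 ∧
      drivingFunction (φs k) (Literature.Probability.Percolation.bondInterfaceIn D (Λ (δs k)) ω) = p.2 :=
    ae_exists_pair_of_boxTight P (hφs k) (Literature.Probability.Percolation.bondInterfaceIn D (Λ (δs k)))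
      (fun ε hε ↦ (hbox ε hε).imp fun δγ ⟨δW, T, hδγ, hδW, hall⟩ ↦ ⟨δW, T, hδγ, hδW, hall k⟩)
  -- the candidate: the capacity-`u` head of the Loewner trace of the driving function
  obtain ⟨crv, hcrv⟩ : ∃ crv : BondConfig (Site 2) → CurveClass ℂ, ∀ ω, crv ω =
      headClassOfFun (Loewner.trace (drivingFunction (φs k) (Literature.Probability.Percolation.bondInterfaceIn D (Λ (δs k)) ω))) u :=
    ⟨_, fun _ ↦ rfl⟩
  have hcrvG : ∀ (ω : BondConfig (Site 2)) (p : C(ℝ≥0, ℂ) × C(ℝ≥0, ℝ)), p ∈ generatedPairs →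
      drivingFunction (φs k) (Literature.Probability.Percolation.bondInterfaceIn D (Λ (δs k)) ω) = p.2 → crv ω = headClass p.1 u := by
    intro ω p hp hW
    rw [hcrv, hW, Loewner.IsGeneratedByCurve.trace_eq_holds p.2.continuous hp, headClassOfFun_coe]
  have hfac : ∀ ω ω', medialExploration (Λ (δs k)) ω = medialExploration (Λ (δs k)) ω' →
      crv ω = crv ω' := fun ω ω' h ↦ by
    rw [hcrv, hcrv, Literature.Probability.Percolation.bondInterfaceIn_apply, Literature.Probability.Percolation.bondInterfaceIn_apply, medialExplorationCurve_congr h]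
  have hmeas : Measurable crv := measurable_of_medialExploration _ hfac
  have hcount : (Set.range crv).Countable := countable_range_of_medialExploration _ hfac
  refine ⟨crv, hmeas.aemeasurable, ?_, ?_⟩
  · -- a.s. source `0` and trace `γ̂[0, u]`
    filter_upwards [hgood] with ω hω
    obtain ⟨p, hp, hp1, -, -, hW⟩ := hω
    have htr : Loewner.trace (drivingFunction (φs k) (Literature.Probability.Percolation.bondInterfaceIn D (Λ (δs k)) ω)) = p.1 := by
      rw [hW]; exact Loewner.IsGeneratedByCurve.trace_eq_holds p.2.continuous hp
    rw [hcrvG ω p hp hW, htr, source_headClass, range_headClass p.1 hu]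
    exact ⟨hp1, rfl⟩
  · -- the crossing bound
    intro F hF hFne z₀ hz₀ S _ hSsub
    obtain ⟨x, ρ, ρ', hρ, hρ', κ, hκ, pref, Rev, hmeasd, hdet, hcl⟩ := hk F hF hFne z₀ hz₀
    -- the a.s. good set
    set G : Set (BondConfig (Site 2)) := {ω | ∃ p : C(ℝ≥0, ℂ) × C(ℝ≥0, ℝ), p ∈ generatedPairs ∧
      p.1 0 = 0 ∧ p.2 0 = 0 ∧ Literature.Probability.Percolation.bondInterfaceIn D (Λ (δs k)) ω =
        compactifiedClass (φs k).boundaryExtension ((orientedFaceDomain hΛ (hadm k)).pt 1) p.1 ∧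
      drivingFunction (φs k) (Literature.Probability.Percolation.bondInterfaceIn D (Λ (δs k)) ω) = p.2} with hG
    have hGae : ∀ᵐ ω ∂P, ω ∈ G := by
      filter_upwards [hgood] with ω hω
      exact hω
    have hGc : P Gᶜ = 0 := mem_ae_iff.1 hGae
    -- the events
    set X : Set (CurveClass ℂ) := {c | c.startFrom F ∈ CurveClass.crossingIn ((z₀ : ℝ) : ℂ)
      (2 * Real.sqrt u) (C * (2 * Real.sqrt u)) univ} with hX
    set T : Set κ := {d | ∃ ω ∈ G, pref ω = d ∧ CurveClass.stopAt F (crv ω) ∈ S} with hTdef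
    have h1 : crv ⁻¹' (CurveClass.stopAt F ⁻¹' S) ∩ G ⊆ pref ⁻¹' T :=
      fun ω ⟨hω, hωG⟩ ↦ ⟨ω, hωG, rfl, hω⟩
    have h2 : pref ⁻¹' T ∩ G ⊆ crv ⁻¹' (CurveClass.stopAt F ⁻¹' S) := by
      rintro ω ⟨⟨ω₁, hω₁G, hpref, hS₁⟩, hωG⟩
      obtain ⟨p, hp, hp1, hp2, hYp, hWp⟩ := hωG
      obtain ⟨p₁, hp₁, hp₁1, hp₁2, hYp₁, hWp₁⟩ := hω₁G
      have key := (hcl ω p hp hp1 hp2 hYp hWp).1 ω₁ p₁ hp₁ hp₁1 hp₁2 hYp₁ hWp₁ hpref.symm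
      change CurveClass.stopAt F (crv ω) ∈ S
      rw [hcrvG ω p hp hWp, key, ← hcrvG ω₁ p₁ hp₁ hWp₁]
      exact hS₁
    have hE : ∀ ω ∈ crv ⁻¹' X ∩ G ∩ crv ⁻¹' (CurveClass.stopAt F ⁻¹' S), pref ω ∈ T →
        ω ∈ annulusOpenCrossingOff (Rev (pref ω)) x (δs k) ρ ρ' ∪
          annulusDualCrossingOff (Rev (pref ω)) x (δs k) ρ ρ' := by
      rintro ω ⟨⟨hωX, hωG⟩, hωS⟩ -
      obtain ⟨p, hp, hp1, hp2, hYp, hWp⟩ := hωG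
      have hc := hcrvG ω p hp hWp
      refine (hcl ω p hp hp1 hp2 hYp hWp).2 ?_ ?_
      · rw [← hc]; exact hSsub hωS
      · rw [← hc]; exact hωX
    have hc : ∀ S' : Set (Sym2 (Site 2)), P (annulusOpenCrossingOff S' x (δs k) ρ ρ' ∪
        annulusDualCrossingOff S' x (δs k) ρ ρ') ≤ 2⁻¹ := fun S' ↦ by
      simpa only [one_mul, div_one] using hhalf S' x (δs k) ρ ρ' (hpos k) hρ hρ'
    haveI : Countable κ := hκ
    calc P.map crv (CurveClass.stopAt F ⁻¹' S ∩ X)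
        = P (crv ⁻¹' (CurveClass.stopAt F ⁻¹' S ∩ X)) := map_apply_of_countable_range hmeas hcount _
      _ = P (crv ⁻¹' (CurveClass.stopAt F ⁻¹' S ∩ X) ∩ G) := (measure_inter_conull hGc).symm
      _ ≤ P (pref ⁻¹' T ∩ (crv ⁻¹' X ∩ G ∩ crv ⁻¹' (CurveClass.stopAt F ⁻¹' S))) :=
          measure_mono (by
            rintro ω ⟨⟨hS', hX'⟩, hG'⟩
            exact ⟨h1 ⟨hS', hG'⟩, ⟨hX', hG'⟩, hS'⟩)
      _ ≤ 2⁻¹ * P (pref ⁻¹' T) :=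
          measure_preimage_inter_le_mul_of_freshArm (hpos k) pref Rev hmeasd hdet hE hc
      _ = 2⁻¹ * P (pref ⁻¹' T ∩ G) := by rw [measure_inter_conull hGc]
      _ ≤ 2⁻¹ * P (crv ⁻¹' (CurveClass.stopAt F ⁻¹' S)) := mul_le_mul_right (measure_mono h2) _
      _ = 2⁻¹ * P.map crv (CurveClass.stopAt F ⁻¹' S) := by
          rw [map_apply_of_countable_range hmeas hcount]

end Driver

/-- **Registered-shape form** (glue sub-goal `faceG2_percFaceHalfPlaneG2_of_annulusTransfer` of
stmt-CriticalPhenomena-0746): the deterministic annulus-transfer input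
`Driver.PercFaceAnnulusTransfer` implies STUB A2″ `Driver.PercFaceHalfPlaneG2` (Condition G2 in
`ℍ` for the bond-`ℤ²` interfaces in the oriented face domains).
[cite: KemppainenSmirnov2017, §4.2 Prop. 4.7 and Remark 4.8, §2.2 Prop. 2.6] -/
theorem faceG2_percFaceHalfPlaneG2_of_annulusTransfer : Driver.PercFaceAnnulusTransfer → Driver.PercFaceHalfPlaneG2 :=
  fun h ↦ Driver.percFaceHalfPlaneG2_of_annulusTransfer h

end Summit.CriticalPhenomena.CardyFormulaZ2.Cruxes.CardyRigidity.CrossingMartingale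

end
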